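/-
Copyright (c) 2026 the pub-hodgecm-mathlib formalisation cell (harness21).  Prover seat hodgecm-mathlib-K2Liu-p14 (g0): Track B «K2-LIT»,
hLiu418 = stmt-HodgeConjecture-24832; LEAD F0P6-plan (g13) RULING M-157b 2026-09-04T08:37:16Z «G5 (β) GODEMENT SECTIONS EXHAUST», file (β1).
-/
import Literature.NumberTheory.Automorphic.TateLocalFactorsProofs          -- ★ `tateZeta`, `SchwartzBruhat`, `isOpen/isCompact_units_valuation_eq_one`, `Units.borelSpace`
import Literature.NumberTheory.Automorphic.CongruenceSubgroupExpansionGL    -- ★ `glInt`, `congruenceGL`, `conj_mem_congruenceGL`, `isUnit_det_and_valBound_inv`, `diagonalGL`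
import HarnessLib

/-!
# Crux `HLiu418`, road `K2_Liu`, Road Φ organ G5 (β) «Godement sections exhaust the flat sections», file (β1):
# THE PRIMITIVE-SHELL SCHWARTZ FUNCTION OF A FLAT LOCAL SECTION OF `GL₂` — constant Godement coefficient

Cell `hodgecm-mathlib`, crux item hLiu418 = `stmt-HodgeConjecture-24832`; squad K2 ∕ K2Liu; prover K2Liu-p14 (g0).
THEOREMS ONLY (no `def`, no instance, no notation, no named-fact hypothesis, no `sorry`); lane `--supports stmt-HodgeConjecture-24832`
(count-neutral helper).  GENERIC non-archimedean local field `F` (`ValuativeRel`, ★ `TateLocalFactors` currency), `K = GL₂(𝒪) =` ★ `glInt 2 F`.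

THE STATEMENT (RULING M-157b (β1), the 2-dimensional `GL₂`-equivariant twin of ★ `exists_schwartzBruhat_tateZeta_eq_const`).  A FLAT smooth
section of the unramified-character principal series `Ind_B^{GL₂(F)}(|·|^s, |·|^{−s})` is determined by its restriction `F₀` to `K`, a function
with `F₀(p k) = F₀(k)` for `p ∈ B(𝒪) = B ∩ K` (the inducing characters are trivial on units) and `F₀(k u) = F₀(k)` for `u` in a principal
congruence subgroup `K_γ` (smoothness).  Put `Prim = 𝒪² ∖ 𝔭² = e₂·K` (primitive vectors) and `Φ := F₀ ∘ κ` on `Prim`, `0` off `Prim`, where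
`κ(x)` is any `k ∈ K` with bottom row `e₂ k = x` (well defined: `F₀` only sees the bottom row, §2).  Then
* §2 `Φ` is a Schwartz–Bruhat function on `F²` (locally constant: `x + t = e₂·(u k)` with `u = (1 0; c₁ 1+c₂) ∈ K_γ`, and `K_γ ⊲ K`; support in `𝒪²`);
* part 2 (`K2LiuGL2GodementCoefficientFinite`, split at the 400-line rule) §3: for every `k ∈ K` and EVERY `z`, `∫_{Fˣ} Φ(a · e₂k) |a|^z dμ'(a) =
  μ'(𝒪ˣ) · F₀(k)` (on the unit shell `a e₂ k = e₂ diag(1,a) k` — §1 here — and `F₀(diag(1,a)k) = F₀(k)`; off it `a e₂ k` is not primitive), and §4: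
  on `GL₂(F) = B·K`, `|det g|^s ∫ Φ(a e₂ g)|a|^{2s} dμ' = μ'(𝒪ˣ)|b₀₀|^s|b₁₁|^{−s} F₀(k)` for `g = b k` — the Godement section `f_Φ(·,s)` IS `μ'(𝒪ˣ)` times the flat
  section through `F₀`, for every `s`, with no `K`-type theory and no Jacquet-functional surjectivity (RULING M-157b (β1)); file (β4) tensors these
  into `piSchwartzBruhat` against ★ `mirabolicEisenstein`.
HONEST LABEL.  `HC_CM` is proved only modulo the 7 printed citations (2 remaining named inputs: hLiu418 = `stmt-HodgeConjecture-24832`,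
h413 = `stmt-HodgeConjecture-24833`) until rung 0 closes.

## References
* [JacquetLanglands1970] H. Jacquet, R. P. Langlands, *Automorphic forms on GL(2)*, LNM 114 (1970), §3 (the sections `f_Φ` of the principal series from
  Schwartz functions on `F²`).
* [Bump1997] D. Bump, *Automorphic Forms and Representations* (1997), §3.7 (Godement sections `f_Φ(g) = |det g|^s ∫ Φ((0,t)g)|t|^{2s} d^×t`), Prop. 4.5.2.
* [CogdellAnalyticTheory2004] J. W. Cogdell, *Analytic theory of L-functions for GL_n*, §2.3 (`F(g, Φ; s) = |det g|^s ∫ Φ(a e_n g)|a|^{ns} d^×a`).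
* [Tate1950] J. Tate, *Fourier analysis in number fields and Hecke's zeta-functions* (1950), §2.4–2.5 (test functions on the unit shell).
-/

set_option autoImplicit false
set_option linter.dupNamespace false -- the mandated namespace repeats `HodgeConjecture.HodgeConjecture`

noncomputable section

open MeasureTheory ValuativeRel
open scoped NNReal MatrixGroups Topology Matrix
open Literature.NumberTheory.GaloisRepresentations Literature.NumberTheory.GaloisRepresentations.IsNonarchimedeanLocalField
open Literature.NumberTheory.Automorphic

namespace Summit.HodgeConjecture.HodgeConjecture.Cruxes.HLiu418.K2LiuGL2GodementSectionOfFlatFinite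

/-! ## §1 Primitive vectors, bottom rows of `K = GL₂(𝒪)`, the unit twist `diag(1, a)`

«`x` primitive» is spelled inline as `(∀ j, valuation F (x j) ≤ 1) ∧ ∃ j, valuation F (x j) = 1` (no definition is introduced). -/

section Algebra

variable {F : Type*} [Field F] [ValuativeRel F]

omit [ValuativeRel F] in
/-- the bottom row: `e₂ ᵥ* k = k 1`. [folklore] -/
theorem single_one_vecMul_eq (k : Matrix (Fin 2) (Fin 2) F) : (Pi.single 1 1 : Fin 2 → F) ᵥ* k = k 1 :=
  Matrix.single_one_vecMul 1 k

/-- **rows of `k ∈ GL₂(𝒪)` are primitive** (entries integral; if both entries of a row were in `𝔭` the determinant would be in `𝔭`).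
[cite: Bump1997, Prop. 4.5.2] -/
theorem prim_apply_of_mem_glInt {k : GL (Fin 2) F} (hk : k ∈ glInt 2 F) (i : Fin 2) :
    (∀ j, valuation F ((k : Matrix (Fin 2) (Fin 2) F) i j) ≤ 1) ∧ ∃ j, valuation F ((k : Matrix (Fin 2) (Fin 2) F) i j) = 1 := by
  refine ⟨fun j => valuation_apply_le_one_of_mem_glInt hk i j, ?_⟩
  by_contra h
  push Not at h
  have hlt : ∀ j, valuation F ((k : Matrix (Fin 2) (Fin 2) F) i j) < 1 :=
    fun j => lt_of_le_of_ne (valuation_apply_le_one_of_mem_glInt hk i j) (h j)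
  have hle : ∀ i' j, valuation F ((k : Matrix (Fin 2) (Fin 2) F) i' j) ≤ 1 := fun i' j => valuation_apply_le_one_of_mem_glInt hk i' j
  have hdet := valuation_det_eq_one_of_mem_glInt hk
  rw [Matrix.det_fin_two] at hdet
  -- both products contain an entry of row `i`
  have h1 : valuation F ((k : Matrix (Fin 2) (Fin 2) F) 0 0 * (k : Matrix (Fin 2) (Fin 2) F) 1 1) < 1 := by
    rw [map_mul]
    fin_cases i
    · exact (mul_le_mul' le_rfl (hle 1 1)).trans_lt (by rw [mul_one]; exact hlt 0)
    · exact (mul_le_mul' (hle 0 0) le_rfl).trans_lt (by rw [one_mul]; exact hlt 1)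
  have h2 : valuation F ((k : Matrix (Fin 2) (Fin 2) F) 0 1 * (k : Matrix (Fin 2) (Fin 2) F) 1 0) < 1 := by
    rw [map_mul]
    fin_cases i
    · exact (mul_le_mul' le_rfl (hle 1 0)).trans_lt (by rw [mul_one]; exact hlt 1)
    · exact (mul_le_mul' (hle 0 1) le_rfl).trans_lt (by rw [one_mul]; exact hlt 0)
  have : valuation F ((k : Matrix (Fin 2) (Fin 2) F) 0 0 * (k : Matrix (Fin 2) (Fin 2) F) 1 1 -
      (k : Matrix (Fin 2) (Fin 2) F) 0 1 * (k : Matrix (Fin 2) (Fin 2) F) 1 0) < 1 :=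
    (Valuation.map_sub _ _ _).trans_lt (max_lt h1 h2)
  exact this.ne hdet

/-- **a primitive vector is the bottom row of some `k ∈ GL₂(𝒪)`** (`(1 0; x₀ x₁)` if `|x₁| = 1`, `(0 −1; x₀ x₁)` if `|x₀| = 1`).
[cite: Bump1997, Prop. 4.5.2] -/
theorem exists_glInt_apply_one_eq {x : Fin 2 → F} (hx : (∀ j, valuation F (x j) ≤ 1) ∧ ∃ j, valuation F (x j) = 1) :
    ∃ k ∈ glInt 2 F, (k : Matrix (Fin 2) (Fin 2) F) 1 = x := by
  obtain ⟨hle, j, hj⟩ := hx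
  have hone : (1 : F) ∈ 𝒪[F] := (Valuation.mem_integer_iff _ _).2 (by rw [map_one])
  have hzero : (0 : F) ∈ 𝒪[F] := (Valuation.mem_integer_iff _ _).2 (by simp)
  have hx' : ∀ j, x j ∈ 𝒪[F] := fun j => (Valuation.mem_integer_iff _ _).2 (hle j)
  fin_cases j
  · -- `|x 0| = 1`: `k = (0 −1; x 0  x 1)`, `det k = x 0`
    have hdet : (!![0, -1; x 0, x 1] : Matrix (Fin 2) (Fin 2) F).det = x 0 := by simp [Matrix.det_fin_two]
    have hx0 : x 0 ≠ 0 := fun h0 => by simp [h0] at hj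
    refine ⟨Matrix.GeneralLinearGroup.mkOfDetNeZero _ (hdet ▸ hx0), mem_glInt_of_isIntegralMatrix ?_ ?_, ?_⟩
    · intro i j
      fin_cases i <;> fin_cases j
      · exact hzero
      · exact neg_mem hone
      · exact hx' 0
      · exact hx' 1
    · show valuation F (Matrix.det !![0, -1; x 0, x 1]) = 1
      rw [hdet]; exact hj
    · ext j; fin_cases j <;> rfl
  · -- `|x 1| = 1`: `k = (1 0; x 0  x 1)`, `det k = x 1`
    have hdet : (!![1, 0; x 0, x 1] : Matrix (Fin 2) (Fin 2) F).det = x 1 := by simp [Matrix.det_fin_two]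
    have hx1 : x 1 ≠ 0 := fun h0 => by simp [h0] at hj
    refine ⟨Matrix.GeneralLinearGroup.mkOfDetNeZero _ (hdet ▸ hx1), mem_glInt_of_isIntegralMatrix ?_ ?_, ?_⟩
    · intro i j
      fin_cases i <;> fin_cases j
      · exact hone
      · exact hzero
      · exact hx' 0
      · exact hx' 1
    · show valuation F (Matrix.det !![1, 0; x 0, x 1]) = 1
      rw [hdet]; exact hj
    · ext j; fin_cases j <;> rfl

omit [ValuativeRel F] in
/-- **the unit twist**: `a · (e₂ k) = e₂ · (diag(1, a) k)`. [cite: Bump1997, §3.7] -/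
theorem smul_apply_one_eq_diagonalGL_mul (a : Fˣ) (k : GL (Fin 2) F) :
    (a : F) • ((k : Matrix (Fin 2) (Fin 2) F) 1) = ((diagonalGL (Fin 2) F ![1, a] * k : GL (Fin 2) F) : Matrix (Fin 2) (Fin 2) F) 1 := by
  ext j
  rw [Units.val_mul, coe_diagonalGL, Matrix.diagonal_mul, Pi.smul_apply, smul_eq_mul]
  rfl

/-- `diag(1, a) ∈ GL₂(𝒪)` for a unit `a`, and it is upper triangular. [cite: Bump1997, Prop. 4.5.2] -/
theorem diagonalGL_one_mem_glInt {a : Fˣ} (ha : valuation F (a : F) = 1) : diagonalGL (Fin 2) F ![1, a] ∈ glInt 2 F :=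
  diagonalGL_mem_glInt fun i => by fin_cases i <;> simp [ha]

omit [ValuativeRel F] in
/-- `diag(1, a)` has vanishing `(1,0)` entry. [folklore] -/
theorem diagonalGL_one_apply_one_zero (a : Fˣ) : ((diagonalGL (Fin 2) F ![1, a] : GL (Fin 2) F) : Matrix (Fin 2) (Fin 2) F) 1 0 = 0 := by
  rw [coe_diagonalGL, Matrix.diagonal_apply_ne _ (by decide)]

/-- **`a · (e₂ k)` is primitive iff `a` is a unit** (`k ∈ GL₂(𝒪)`). [cite: Bump1997, Prop. 4.5.2] -/
theorem prim_smul_apply_one_iff {k : GL (Fin 2) F} (hk : k ∈ glInt 2 F) (a : Fˣ) :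
    ((∀ j, valuation F (((a : F) • (k : Matrix (Fin 2) (Fin 2) F) 1) j) ≤ 1) ∧
        ∃ j, valuation F (((a : F) • (k : Matrix (Fin 2) (Fin 2) F) 1) j) = 1) ↔ valuation F (a : F) = 1 := by
  obtain ⟨hle, j₀, hj₀⟩ := prim_apply_of_mem_glInt hk 1
  constructor
  · rintro ⟨hle', j₁, hj₁⟩
    simp only [Pi.smul_apply, smul_eq_mul, map_mul] at hle' hj₁
    rcases lt_trichotomy (valuation F (a : F)) 1 with hlt | heq | hgt
    · exfalso
      have : valuation F (a : F) * valuation F ((k : Matrix (Fin 2) (Fin 2) F) 1 j₁) < 1 :=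
        (mul_le_mul' le_rfl (hle j₁)).trans_lt (by rwa [mul_one])
      exact this.ne hj₁
    · exact heq
    · exfalso
      have h := hle' j₀
      rw [hj₀, mul_one] at h
      exact not_lt.2 h hgt
  · intro ha
    rw [smul_apply_one_eq_diagonalGL_mul]
    exact prim_apply_of_mem_glInt (Subgroup.mul_mem _ (diagonalGL_one_mem_glInt ha) hk) 1

omit [ValuativeRel F] in
/-- if `k, k'` have the same bottom row then `k' k⁻¹` is upper triangular. [folklore] -/
theorem mul_inv_apply_one_zero_eq_zero {k k' : GL (Fin 2) F} (h : (k' : Matrix (Fin 2) (Fin 2) F) 1 = (k : Matrix (Fin 2) (Fin 2) F) 1) :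
    ((k' * k⁻¹ : GL (Fin 2) F) : Matrix (Fin 2) (Fin 2) F) 1 0 = 0 := by
  have h1 : ((k' * k⁻¹ : GL (Fin 2) F) : Matrix (Fin 2) (Fin 2) F) 1 = ((k * k⁻¹ : GL (Fin 2) F) : Matrix (Fin 2) (Fin 2) F) 1 := by
    ext j
    rw [Units.val_mul, Units.val_mul, Matrix.mul_apply, Matrix.mul_apply]
    simp only [h]
  rw [congrFun h1 0, mul_inv_cancel, Units.val_one, Matrix.one_apply_ne (by decide)]

end Algebra

/-! ## §2 The primitive-shell Schwartz function of a flat smooth datum `F₀` -/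

section Schwartz

variable {F : Type*} [Field F] [ValuativeRel F] [TopologicalSpace F] [IsNonarchimedeanLocalField F]
  (F₀ : GL (Fin 2) F → ℂ)
  (hB : ∀ p ∈ glInt 2 F, (p : Matrix (Fin 2) (Fin 2) F) 1 0 = 0 → ∀ k ∈ glInt 2 F, F₀ (p * k) = F₀ k)

include hB

omit [TopologicalSpace F] [IsNonarchimedeanLocalField F] in
/-- a `B(𝒪)`-invariant datum only sees the BOTTOM ROW on `K`: `e₂ k' = e₂ k ⇒ F₀ k' = F₀ k`. [cite: Bump1997, §3.7] -/
theorem apply_eq_of_apply_one_eq {k k' : GL (Fin 2) F} (hk : k ∈ glInt 2 F) (hk' : k' ∈ glInt 2 F)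
    (h : (k' : Matrix (Fin 2) (Fin 2) F) 1 = (k : Matrix (Fin 2) (Fin 2) F) 1) : F₀ k' = F₀ k := by
  have hp : k' * k⁻¹ ∈ glInt 2 F := Subgroup.mul_mem _ hk' (Subgroup.inv_mem _ hk)
  have := hB _ hp (mul_inv_apply_one_zero_eq_zero h) k hk
  rwa [inv_mul_cancel_right] at this

/-- **THE PRIMITIVE-SHELL SCHWARTZ FUNCTION.**  For `F₀ : GL₂(F) → ℂ` left-invariant under `B(𝒪)` on `K` (`hB`) and right-invariant under a
principal congruence subgroup `K_γ` on `K` (`0 ≠ γ < 1`), there is a Schwartz–Bruhat `Φ` on `F²`, vanishing off the primitive vectors, with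
`Φ(e₂ k) = F₀(k)` for every `k ∈ K`. [cite: JacquetLanglands1970, §3] [cite: Bump1997, §3.7] [cite: Tate1950, §2.5] -/
theorem exists_schwartzBruhat_of_flat {γ : ValueGroupWithZero F} (hγ0 : γ ≠ 0) (hγ : γ < 1)
    (hlev : ∀ k ∈ glInt 2 F, ∀ u ∈ congruenceGL 2 γ, F₀ (k * u) = F₀ k) :
    ∃ Φ : (Fin 2 → F) → ℂ, Φ ∈ SchwartzBruhat (Fin 2 → F) ∧
      (∀ x : Fin 2 → F, ¬ ((∀ j, valuation F (x j) ≤ 1) ∧ ∃ j, valuation F (x j) = 1) → Φ x = 0) ∧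
      ∀ k ∈ glInt 2 F, Φ ((k : Matrix (Fin 2) (Fin 2) F) 1) = F₀ k := by
  classical
  haveI : T2Space F := (Literature.NumberTheory.GaloisRepresentations.IsNonarchimedeanLocalField.isLocalField F).toT2Space
  -- the function
  let Φ : (Fin 2 → F) → ℂ := fun x =>
    if h : (∀ j, valuation F (x j) ≤ 1) ∧ ∃ j, valuation F (x j) = 1 then F₀ (Classical.choose (exists_glInt_apply_one_eq h)) else 0
  have hΦprim : ∀ {x : Fin 2 → F} (h : (∀ j, valuation F (x j) ≤ 1) ∧ ∃ j, valuation F (x j) = 1) {k : GL (Fin 2) F},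
      k ∈ glInt 2 F → (k : Matrix (Fin 2) (Fin 2) F) 1 = x → Φ x = F₀ k := by
    intro x h k hk hkx
    simp only [Φ, dif_pos h]
    obtain ⟨hk₀, hk₀x⟩ := Classical.choose_spec (exists_glInt_apply_one_eq h)
    exact apply_eq_of_apply_one_eq F₀ hB hk hk₀ (hk₀x.trans hkx.symm)
  have hΦ0 : ∀ x : Fin 2 → F, ¬ ((∀ j, valuation F (x j) ≤ 1) ∧ ∃ j, valuation F (x j) = 1) → Φ x = 0 :=
    fun x h => by simp only [Φ, dif_neg h]
  refine ⟨Φ, ?_, hΦ0, fun k hk => hΦprim (prim_apply_of_mem_glInt hk 1) hk rfl⟩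
  rw [mem_schwartzBruhat_iff]
  constructor
  · -- locally constant
    rw [IsLocallyConstant.iff_exists_open]
    intro x
    by_cases hx : (∀ j, valuation F (x j) ≤ 1) ∧ ∃ j, valuation F (x j) = 1
    · -- around a primitive `x = e₂ k`: `y = e₂ (u k)` with `u = (1 0; c₀ 1+c₁) ∈ K_γ`
      obtain ⟨k, hk, hkx⟩ := exists_glInt_apply_one_eq hx
      refine ⟨{y | ∀ j, valuation F ((y - x) j) ≤ γ}, ?_, fun j => by simp, fun y hy => ?_⟩
      · have : {y : Fin 2 → F | ∀ j, valuation F ((y - x) j) ≤ γ} = ⋂ j, (fun y : Fin 2 → F => y j - x j) ⁻¹' {z | valuation F z ≤ γ} := by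
          ext y; simp
        rw [this]
        exact isOpen_iInter_of_finite fun j =>
          (DeltaCharBorel.isOpen_setOf_valuation_le hγ0).preimage ((continuous_apply j).sub continuous_const)
      · -- the element `u`
        set c : Fin 2 → F := (y - x) ᵥ* ((k⁻¹ : GL (Fin 2) F) : Matrix (Fin 2) (Fin 2) F) with hc
        have hcγ : ∀ j, valuation F (c j) ≤ γ := by
          intro j
          have hcj : c j = ∑ i, (y - x) i * ((k⁻¹ : GL (Fin 2) F) : Matrix (Fin 2) (Fin 2) F) i j := rfl
          rw [hcj]
          refine (Valuation.map_sum_le _ fun i _ => ?_)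
          rw [map_mul]
          exact (mul_le_mul' (hy i) (valuation_apply_le_one_of_mem_glInt (Subgroup.inv_mem _ hk) i j)).trans (by rw [mul_one])
        set U : Matrix (Fin 2) (Fin 2) F := !![1, 0; c 0, 1 + c 1] with hU
        have hU1 : ValBound γ (U - 1) := by
          intro i j
          fin_cases i <;> fin_cases j
          · simp [hU]
          · simp [hU]
          · simpa [hU] using hcγ 0
          · simpa [hU] using hcγ 1
        obtain ⟨hUdet, hUinv1, hUinvγ⟩ := isUnit_det_and_valBound_inv hU1 hγ
        set u : GL (Fin 2) F := Matrix.GeneralLinearGroup.mk'' U hUdet with hu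
        have hucoe : (u : Matrix (Fin 2) (Fin 2) F) = U := rfl
        have huγ : u ∈ congruenceGL 2 γ := by
          refine ⟨⟨?_, ?_⟩, ?_, ?_⟩
          · rw [hucoe]; exact hU1.of_sub_one hγ.le
          · rw [Matrix.coe_units_inv, hucoe]; exact hUinv1
          · rw [hucoe]; exact hU1
          · rw [Matrix.coe_units_inv, hucoe]; exact hUinvγ
        have huK : u ∈ glInt 2 F := congruenceGL_le_glInt _ huγ
        -- `e₂ (u k) = e₂ k + c k = y`
        have hrow : ((u * k : GL (Fin 2) F) : Matrix (Fin 2) (Fin 2) F) 1 = y := by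
          have h1 : (U 1) = Pi.single 1 1 + c := by
            ext j; fin_cases j <;> simp [hU]
          have h2 : ((u * k : GL (Fin 2) F) : Matrix (Fin 2) (Fin 2) F) 1 = (U 1) ᵥ* (k : Matrix (Fin 2) (Fin 2) F) := by
            ext j; rw [Units.val_mul, hucoe, Matrix.mul_apply]; rfl
          rw [h2, h1, Matrix.add_vecMul, single_one_vecMul_eq, hc, Matrix.vecMul_vecMul, ← Units.val_mul, inv_mul_cancel,
            Units.val_one, Matrix.vecMul_one, hkx, add_sub_cancel]
        have hyprim : (∀ j, valuation F (y j) ≤ 1) ∧ ∃ j, valuation F (y j) = 1 := by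
          rw [← hrow]; exact prim_apply_of_mem_glInt (Subgroup.mul_mem _ huK hk) 1
        rw [hΦprim hyprim (Subgroup.mul_mem _ huK hk) hrow, hΦprim hx hk hkx]
        -- `F₀ (u k) = F₀ (k (k⁻¹ u k)) = F₀ k` by normality of `K_γ` in `K`
        have hconj : k⁻¹ * u * k⁻¹⁻¹ ∈ congruenceGL 2 γ := conj_mem_congruenceGL (Subgroup.inv_mem _ hk) huγ
        rw [inv_inv] at hconj
        have := hlev k hk _ hconj
        rwa [← mul_assoc, ← mul_assoc, mul_inv_cancel, one_mul] at this
    · -- around a non-primitive `x`: the ball `{∀ j, |y j − x j| < 1}` contains no primitive vector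
      refine ⟨{y | ∀ j, valuation F ((y - x) j) < 1}, ?_, fun j => by simp, fun y hy => ?_⟩
      · have : {y : Fin 2 → F | ∀ j, valuation F ((y - x) j) < 1} = ⋂ j, (fun y : Fin 2 → F => y j - x j) ⁻¹' {z | valuation F z < 1} := by
          ext y; simp
        rw [this]
        exact isOpen_iInter_of_finite fun j =>
          (DeltaCharBorel.isOpen_setOf_valuation_lt 1).preimage ((continuous_apply j).sub continuous_const)
      · have hyj : ∀ j, y j = (y - x) j + x j := fun j => by simp
        have hy' : ¬ ((∀ j, valuation F (y j) ≤ 1) ∧ ∃ j, valuation F (y j) = 1) := by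
          rintro ⟨hyle, j₁, hj₁⟩
          apply hx
          by_cases hxle : ∀ j, valuation F (x j) ≤ 1
          · -- then some `|x j| = 1`, else all `|y j| < 1`
            refine ⟨hxle, ?_⟩
            by_contra hne
            push Not at hne
            have : valuation F (y j₁) < 1 := by
              rw [hyj j₁]
              exact (Valuation.map_add _ _ _).trans_lt (max_lt (hy j₁) (lt_of_le_of_ne (hxle j₁) (hne j₁)))
            exact this.ne hj₁
          · exfalso
            push Not at hxle
            obtain ⟨j₂, hj₂⟩ := hxle
            have hval : valuation F (y j₂) = valuation F (x j₂) := by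
              rw [hyj j₂]
              exact Valuation.map_add_eq_of_lt_right _ ((hy j₂).trans hj₂)
            exact not_lt.2 (hyle j₂) (hval ▸ hj₂)
        rw [hΦ0 y hy', hΦ0 x hx]
  · -- compact support inside `𝒪²`
    refine HasCompactSupport.intro (K := Set.pi Set.univ fun _ : Fin 2 => {z : F | valuation F z ≤ 1})
      (isCompact_univ_pi fun _ => IsNonarchimedeanLocalField.isCompact_closedBall F 1) fun x hx => hΦ0 x ?_
    rintro ⟨hle, -⟩
    exact hx fun j _ => hle j

end Schwartz

end Summit.HodgeConjecture.HodgeConjecture.Cruxes.HLiu418.K2LiuGL2GodementSectionOfFlatFinite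

end
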